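import Summits.AnomalousDissipation.AnomalousDissipation.Theorems.ScalarAnomalySteadySourceFormal.Negative.ForcedClassicalWeak
import Summits.AnomalousDissipation.AnomalousDissipation.Theorems.ScalarAnomalySteadySourceFormal.Negative.ForcedToolkit
import Literature.Analysis.FluidPDE.PassiveScalarFourier
import Literature.Analysis.FluidPDE.PassiveScalarEnergyPointwise
import Literature.Analysis.FluidPDE.EulerReynolds
import Literature.Analysis.FunctionSpaces.TorusInverseLaplacian
import Literature.Analysis.FunctionSpaces.TorusScalarTrigPoly
import Literature.Analysis.FunctionSpaces.TorusFourierConvolution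
import Literature.Analysis.FunctionSpaces.TorusSobolevNormFacts
import Literature.Analysis.FluidPDE.TorusHeatForcedIcc

/-!
# Negative knowledge for the crux `ScalarAnomalySteadySourceFormal` (stmt-AnomalousDissipation-0448), IV-a:
# the flow at rest — Volterra lemma, steady state, exact modal decay

Certified copy of the first half of §6 of the cdisprove work file: the a.e. linear VOLTERRA lemma
`ae_eq_exp_of_volterra` (`z = z₀ - a∫₀ᵗ z` a.e. forces `z(t) = e^{-at}z₀` a.e.), the single-mode Bessel
bound, the STEADY STATE `-(1/ν)Δ⁻¹h` of the sourced heat equation (classical ⇒ weak, Fourier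
coefficients `ĥ_k/(νλ_k)`), the fluctuation `θ - θ_p` of a rest-flow witness as a homogeneous weak solution
(`tilde_isWeak`, by `forced_sub`), its uniform `L²` bound (tree energy inequality) and the EXACT decay of
its modes (`tilde_mode_eq`, tree modewise identity + Volterra).  Supports stmt-AnomalousDissipation-0448.
-/

set_option linter.dupNamespace false

noncomputable section

open scoped BigOperators Topology ENNReal NNReal InnerProductSpace ContDiff
open Filter Set Function MeasureTheory UnitAddTorus Complex

namespace Summit.AnomalousDissipation.AnomalousDissipation.Theorems.ScalarAnomalySteadySourceFormal.Negative

open Literature.Analysis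
open Literature.Analysis.FunctionSpaces Literature.Analysis.FunctionSpaces.Torus
open Literature.Analysis.FluidPDE Literature.Analysis.FluidPDE.Torus

variable {d : Type*} [Fintype d]


variable {d : Type*} [Fintype d]

/-! ### A.e. linear Volterra equations: `z = z₀ - a ∫₀ᵗ z` forces `z(t) = e^{-at} z₀` -/

section Volterra

/-- **A.e. solutions of the linear Volterra equation are exponentials.** If `z ∈ L¹(0,T)` and
`z(t) = z₀ + ∫_{(0,t]} (-a) z` for a.e. `t ∈ (0,T)`, then `z(t) = e^{-at} z₀` for a.e. `t ∈ (0,T)`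
(the continuous representative `w(t) = z₀ - a∫₀ᵗ z` solves `w' = -aw` classically on `(0,T)`,
`e^{at} w` is constant there and continuous on `[0,T]`). [folklore] -/
theorem ae_eq_exp_of_volterra {z : ℝ → ℂ} {T : ℝ} {a z₀ : ℂ} (hz : IntegrableOn z (Ioo 0 T) volume)
    (h : ∀ᵐ t ∂(volume.restrict (Ioo 0 T)), z t = z₀ + ∫ s in Ioc 0 t, -a * z s) :
    ∀ᵐ t ∂(volume.restrict (Ioo 0 T)), z t = Complex.exp (-a * t) * z₀ := by
  rcases le_or_gt T 0 with hT | hT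
  · rw [Ioo_eq_empty (not_lt.2 hT), Measure.restrict_empty, ae_zero]
    exact eventually_bot
  -- the continuous representative
  set w : ℝ → ℂ := fun t => z₀ + ∫ s in Ioc 0 t, -a * z s with hw_def
  have hzw' : ∀ᵐ t ∂(volume : Measure ℝ), t ∈ Ioo 0 T → z t = w t :=
    (ae_restrict_iff' measurableSet_Ioo).1 h
  -- `-a z = -a w` a.e. on `(0,T)`; integrability of `-a w`
  have haz : IntegrableOn (fun s => -a * z s) (Ioo 0 T) volume := hz.const_mul (-a)
  have haw : IntegrableOn (fun s => -a * w s) (Ioo 0 T) volume := by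
    refine haz.congr_fun_ae ?_
    refine (ae_restrict_iff' measurableSet_Ioo).2 ?_
    filter_upwards [hzw'] with s hs hsI
    rw [hs hsI]
  have hawI : IntegrableOn (fun s => -a * w s) (Icc 0 T) volume :=
    (integrableOn_Icc_iff_integrableOn_Ioo).2 haw
  -- integrals over `(0,t]`, `t ≤ T`, do not see the difference between `z` and `w`
  have hIoc : ∀ t ∈ Icc 0 T, ∫ s in Ioc 0 t, -a * z s = ∫ s in (0 : ℝ)..t, -a * w s := by
    intro t ht
    rw [intervalIntegral.integral_of_le ht.1, integral_Ioc_eq_integral_Ioo, integral_Ioc_eq_integral_Ioo]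
    refine setIntegral_congr_ae measurableSet_Ioo ?_
    filter_upwards [hzw'] with s hs hsI
    rw [hs ⟨hsI.1, hsI.2.trans_le ht.2⟩]
  set W : ℝ → ℂ := fun t => ∫ s in (0 : ℝ)..t, -a * w s with hW_def
  have hwW : ∀ t ∈ Icc 0 T, w t = z₀ + W t := fun t ht => by
    simp only [hw_def, hW_def]; rw [hIoc t ht]
  -- `W`, hence `w`, is continuous on `[0, T]`
  have hWcont : ContinuousOn W (Icc 0 T) := by
    have := intervalIntegral.continuousOn_primitive_interval' (μ := volume)
      (f := fun s => -a * w s) (b₁ := 0) (b₂ := T) (a := 0)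
      ((hawI.mono_set (by rw [uIcc_of_le hT.le])).intervalIntegrable)
      (by rw [uIcc_of_le hT.le]; exact left_mem_Icc.2 hT.le)
    rwa [uIcc_of_le hT.le] at this
  have hwcont : ContinuousOn w (Icc 0 T) :=
    (continuousOn_const.add hWcont).congr fun t ht => hwW t ht
  -- derivative of `W` at interior points
  have hWderiv : ∀ t ∈ Ioo 0 T, HasDerivAt W (-a * w t) t := by
    intro t ht
    have hfc : ContinuousOn (fun s => -a * w s) (Ioo 0 T) :=
      (continuousOn_const.mul hwcont).mono Ioo_subset_Icc_self
    have hsub : uIcc (0 : ℝ) t ⊆ Icc 0 T := by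
      rw [uIcc_of_le ht.1.le]; exact Icc_subset_Icc_right ht.2.le
    refine intervalIntegral.integral_hasDerivAt_right ?_ ?_ ?_
    · exact (hawI.mono_set hsub).intervalIntegrable
    · exact hfc.stronglyMeasurableAtFilter isOpen_Ioo t ht
    · exact hfc.continuousAt (Ioo_mem_nhds ht.1 ht.2)
  have hwderiv : ∀ t ∈ Ioo 0 T, HasDerivAt w (-a * w t) t := by
    intro t ht
    have h1 : HasDerivAt (fun τ => z₀ + W τ) (-a * w t) t := (hWderiv t ht).const_add z₀
    refine h1.congr_of_eventuallyEq ?_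
    filter_upwards [Ioo_mem_nhds ht.1 ht.2] with τ hτ
    exact hwW τ (Ioo_subset_Icc_self hτ)
  -- `v = e^{at} w` has zero derivative on `(0,T)` and is continuous on `[0,T]`
  set v : ℝ → ℂ := fun t => Complex.exp (a * t) * w t with hv_def
  have hexp : ∀ t : ℝ, HasDerivAt (fun τ : ℝ => Complex.exp (a * τ)) (a * Complex.exp (a * t)) t := by
    intro t
    have h1 : HasDerivAt (fun τ : ℝ => a * ((τ : ℝ) : ℂ)) (a * ((1 : ℝ) : ℂ)) t :=
      ((hasDerivAt_id' t).ofReal_comp).const_mul a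
    exact h1.cexp.congr_deriv (by push_cast; ring)
  have hvderiv : ∀ t ∈ Ioo 0 T, HasDerivAt v 0 t := by
    intro t ht
    have h := (hexp t).mul (hwderiv t ht)
    have e : a * Complex.exp (a * t) * w t + Complex.exp (a * t) * (-a * w t) = 0 := by ring
    rwa [e] at h
  have hvcont : ContinuousOn v (Icc 0 T) :=
    ((Complex.continuous_exp.comp (continuous_const.mul Complex.continuous_ofReal)).continuousOn).mul hwcont
  -- `v` is constant on `(0,T)` …
  have hvconst : ∀ x ∈ Ioo 0 T, ∀ y ∈ Ioo 0 T, x ≤ y → v y = v x := by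
    intro x hx y hy hxy
    have hc : ContinuousOn v (Icc x y) := hvcont.mono (Icc_subset_Icc hx.1.le hy.2.le)
    have hd : ∀ t ∈ Ico x y, HasDerivWithinAt v 0 (Ici t) t := fun t ht =>
      (hvderiv t ⟨hx.1.trans_le ht.1, ht.2.trans hy.2⟩).hasDerivWithinAt
    exact constant_of_has_deriv_right_zero hc hd y (right_mem_Icc.2 hxy)
  -- … and, by continuity at `0`, equal to `v 0 = z₀` there
  have hv0 : v 0 = z₀ := by
    simp [hv_def, hw_def]
  have hvx : ∀ x ∈ Ioo 0 T, v x = z₀ := by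
    intro x hx
    haveI : (𝓝[Ioo 0 x] (0 : ℝ)).NeBot := left_nhdsWithin_Ioo_neBot hx.1
    have hlim : Tendsto v (𝓝[Ioo 0 x] 0) (nhds (v 0)) :=
      ((hvcont 0 (left_mem_Icc.2 hT.le)).tendsto).mono_left
        (nhdsWithin_mono _ fun y hy => ⟨hy.1.le, hy.2.le.trans hx.2.le⟩)
    have hlim' : Tendsto v (𝓝[Ioo 0 x] 0) (nhds (v x)) := by
      refine (tendsto_const_nhds (x := v x)).congr' ?_
      filter_upwards [self_mem_nhdsWithin] with y hy
      exact hvconst y ⟨hy.1, hy.2.trans hx.2⟩ x hx hy.2.le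
    rw [← hv0]
    exact tendsto_nhds_unique hlim' hlim
  -- unwind
  have hwx : ∀ x ∈ Ioo 0 T, w x = Complex.exp (-a * x) * z₀ := by
    intro x hx
    have h1 : Complex.exp (a * x) * w x = z₀ := hvx x hx
    have h2 : Complex.exp (-a * x) * (Complex.exp (a * x) * w x) = w x := by
      rw [← mul_assoc, ← Complex.exp_add, show -a * (x : ℂ) + a * x = 0 by ring, Complex.exp_zero, one_mul]
    rw [← h2, h1]
  rw [ae_restrict_iff' measurableSet_Ioo]
  filter_upwards [hzw'] with t ht htI
  rw [ht htI, hwx t htI]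

end Volterra



/-! ### Single-mode Bessel bound and the steady state of the sourced heat equation -/

section SteadyState

/-- **Bessel, one mode**: `‖𝓕θ(k)‖² ≤ ∫ θ²` for a real `θ ∈ L²(T^d)` (one term of Parseval). [folklore] -/
theorem sq_norm_mFourierCoeff_le_integral_sq {θ : UnitAddTorus d → ℝ} (hθ : MemLp θ 2 volume) (k : d → ℤ) :
    ‖mFourierCoeff (fun x => (θ x : ℂ)) k‖ ^ 2 ≤ ∫ x, θ x ^ 2 :=
  le_hasSum (FunctionSpaces.Torus.hasSum_sq_norm_mFourierCoeff_ofReal hθ) k fun _ _ => sq_nonneg _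

variable [DecidableEq d] [Nonempty d]

/-- The STEADY STATE `θ_p = -(1/ν) Δ⁻¹ h` of the sourced heat equation `0 = νΔθ + h` for a smooth
mean-zero source (`Δ Δ⁻¹ h = h - ∫h`, `Torus.laplacian_invLaplacian`). [folklore] -/
def steadyState (ν : ℝ) (h : UnitAddTorus d → ℝ) : UnitAddTorus d → ℝ :=
  (-(ν⁻¹)) • FunctionSpaces.Torus.invLaplacian h

omit [DecidableEq d] [Nonempty d] in
/-- Helper `isSmooth_steadyState` (see the section docstring). [folklore] -/
theorem isSmooth_steadyState (ν : ℝ) {h : UnitAddTorus d → ℝ} (hh : IsSmooth h) :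
    IsSmooth (steadyState ν h) := by
  classical
  exact (FunctionSpaces.Torus.isSmooth_invLaplacian hh).smul _

omit [DecidableEq d] in
/-- `Δθ_p = -(1/ν) h` for a smooth mean-zero `h`. [folklore] -/
theorem laplacian_steadyState {ν : ℝ} {h : UnitAddTorus d → ℝ} (hh : IsSmooth h)
    (hmean : HasZeroMean h) (x : UnitAddTorus d) :
    laplacian (steadyState ν h) x = -(ν⁻¹) * h x := by
  rw [steadyState, FunctionSpaces.Torus.laplacian_const_smul_apply (FunctionSpaces.Torus.isSmooth_invLaplacian hh),
    FunctionSpaces.Torus.laplacian_invLaplacian hh, hmean, sub_zero, smul_eq_mul]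

/-- The steady state solves the sourced heat equation CLASSICALLY with the flow at rest. [folklore] -/
theorem steadyState_isClassical {ν : ℝ} (hν : ν ≠ 0) {h : UnitAddTorus d → ℝ} (hh : IsSmooth h)
    (hmean : HasZeroMean h) :
    IsClassicalScalarTransportForcedOn univ ν (fun (_ : ℝ) (_ : UnitAddTorus d) => (0 : EuclideanSpace ℝ d))
      (fun _ => h) (fun _ => steadyState ν h) where
  smooth_velocity := contDiffOn_const
  smooth_source := isSmoothSpaceTimeOn_const hh univ
  smooth_scalar := isSmoothSpaceTimeOn_const (isSmooth_steadyState ν hh) univ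
  transport := fun t _ x => by
    have h0 : FunctionSpaces.Torus.timeDerivWithin univ (fun (_ : ℝ) => steadyState ν h) t x = 0 := by
      simp [FunctionSpaces.Torus.timeDerivWithin]
    rw [h0, inner_zero_left, zero_add, laplacian_steadyState hh hmean]
    field_simp
    ring
  divFree := fun _ _ x => divergence_zero x

/-- … hence it is a global WEAK solution of the forced class, with datum `θ_p`. [folklore] -/
theorem steadyState_isWeak {ν : ℝ} (hν : ν ≠ 0) {h : UnitAddTorus d → ℝ} (hh : IsSmooth h)
    (hmean : HasZeroMean h) :
    IsWeakScalarTransportForced ν (fun (_ : ℝ) (_ : UnitAddTorus d) => (0 : EuclideanSpace ℝ d))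
      (fun _ => h) (steadyState ν h) (fun _ => steadyState ν h) :=
  isWeakScalarTransportForced_of_classical (steadyState_isClassical hν hh hmean)

end SteadyState


section SteadyStateFourier

variable [DecidableEq d] [Nonempty d]

omit [DecidableEq d] in
/-- **Fourier coefficients of the steady state**: `𝓕θ_p(k) = 𝓕h(k)/(ν·4π²|k|²)` for `k ≠ 0`
(`𝓕(Δw)(k) = -4π²|k|² 𝓕w(k)` and `Δθ_p = -h/ν`). [folklore] -/
theorem mFourierCoeff_steadyState {ν : ℝ} (hν : ν ≠ 0) {h : UnitAddTorus d → ℝ} (hh : IsSmooth h)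
    (hmean : HasZeroMean h) {k : d → ℤ} (hk : k ≠ 0) :
    mFourierCoeff (fun x => (steadyState ν h x : ℂ)) k =
      mFourierCoeff (fun x => (h x : ℂ)) k / ((ν : ℂ) * ((4 * Real.pi ^ 2 * freqNormSq k : ℝ) : ℂ)) := by
  have hθp : IsSmooth (steadyState ν h) := isSmooth_steadyState ν hh
  have hw : IsSmooth (fun x => (steadyState ν h x : ℂ)) := hθp.ofReal
  have h1 := FunctionSpaces.Torus.mFourierCoeff_laplacian_complex hw k
  have h2 : laplacian (fun x => (steadyState ν h x : ℂ)) = fun x => (-(ν⁻¹) : ℝ) • (h x : ℂ) := by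
    funext x
    rw [← FunctionSpaces.Torus.ofReal_laplacian hθp x, laplacian_steadyState hh hmean x, Complex.real_smul]
    push_cast
    ring
  rw [h2, FunctionSpaces.Torus.mFourierCoeff_real_smul] at h1
  have hfk : (0 : ℝ) < freqNormSq k := lt_of_lt_of_le one_pos (FunctionSpaces.Torus.one_le_freqNormSq_of_ne_zero hk)
  have hC : ((4 * Real.pi ^ 2 * freqNormSq k : ℝ) : ℂ) ≠ 0 := by
    exact_mod_cast (by positivity : (4 * Real.pi ^ 2 * freqNormSq k : ℝ) ≠ 0)
  have hν' : (ν : ℂ) ≠ 0 := Complex.ofReal_ne_zero.2 hν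
  rw [eq_div_iff (mul_ne_zero hν' hC)]
  have key : (ν : ℂ) * (((-(ν⁻¹) : ℝ) : ℂ) * mFourierCoeff (fun x => (h x : ℂ)) k) =
      (ν : ℂ) * (-((4 * Real.pi ^ 2 * freqNormSq k : ℝ) : ℂ) * mFourierCoeff (fun x => (steadyState ν h x : ℂ)) k) := by
    rw [h1]
  have e1 : (ν : ℂ) * (((-(ν⁻¹) : ℝ) : ℂ) * mFourierCoeff (fun x => (h x : ℂ)) k) =
      -mFourierCoeff (fun x => (h x : ℂ)) k := by
    push_cast
    field_simp
  rw [e1] at key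
  linear_combination key

end SteadyStateFourier

/-! ### The flow at rest: modes, honest variance, and the no-go -/

section RestFlowCore

variable [DecidableEq d] [Nonempty d]
variable {ν : ℝ} {h θ₀ : UnitAddTorus d → ℝ} {θ : ℝ → UnitAddTorus d → ℝ}

/-- **The fluctuation** `θ̃ = θ - θ_p` about the steady state is a weak solution of the HOMOGENEOUS
heat equation (flow at rest) with datum `θ₀ - θ_p`. [folklore] -/
theorem tilde_isWeak (hν : 0 < ν) (hh : IsSmooth h) (hmean : HasZeroMean h) (hθ₀ : MemLp θ₀ 2 volume)
    (hweak : IsWeakScalarTransportForced ν (fun (_ : ℝ) (_ : UnitAddTorus d) => (0 : EuclideanSpace ℝ d))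
      (fun _ => h) θ₀ θ) {T : ℝ} (hT : 0 < T) :
    IsWeakScalarTransportOn T ν (fun (_ : ℝ) (_ : UnitAddTorus d) => (0 : EuclideanSpace ℝ d))
      (fun x => θ₀ x - steadyState ν h x) (fun t x => θ t x - steadyState ν h x) :=
  forced_sub (hweak T hT) (steadyState_isWeak hν.ne' hh hmean T hT) (hθ₀.integrable one_le_two)
    (isSmooth_steadyState ν hh).integrable

/-- Uniform-in-time `L²` bound on the fluctuation: for a.e. `t ∈ (0,T)`,
`∫⁻ ‖θ̃(t)‖ₑ² ≤ ∫⁻ ‖θ₀ - θ_p‖ₑ²` (energy inequality of the homogeneous heat equation, in tree). [folklore] -/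
theorem tilde_ae_lintegral_sq_le (hν : 0 < ν) (hh : IsSmooth h) (hmean : HasZeroMean h)
    (hθ₀ : MemLp θ₀ 2 volume)
    (hweak : IsWeakScalarTransportForced ν (fun (_ : ℝ) (_ : UnitAddTorus d) => (0 : EuclideanSpace ℝ d))
      (fun _ => h) θ₀ θ) {T : ℝ} (hT : 0 < T) :
    ∀ᵐ t ∂(volume.restrict (Ioo 0 T)),
      ∫⁻ x, ‖θ t x - steadyState ν h x‖ₑ ^ 2 ≤ ∫⁻ x, ‖θ₀ x - steadyState ν h x‖ₑ ^ 2 := by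
  have hdat : MemLp (fun x => θ₀ x - steadyState ν h x) 2 volume :=
    hθ₀.sub ((isSmooth_steadyState ν hh).memLp 2)
  have hu : MemLp (FunctionSpaces.Torus.stLift fun (_ : ℝ) (_ : UnitAddTorus d) => (0 : EuclideanSpace ℝ d)) ∞
      (volume.restrict (Ioo 0 T ×ˢ univ)) := memLp_top_const _
  filter_upwards [IsWeakScalarTransportOn.lintegral_sq_add_le_holds hν (tilde_isWeak hν hh hmean hθ₀ hweak hT) hdat hu]
    with t ht
  exact le_of_add_le_left ht

/-- **Modes of the fluctuation decay exactly**: for every `k` and a.e. `t ∈ (0,T)`,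
`𝓕θ̃(t)(k) = e^{-4π²ν|k|² t} 𝓕(θ₀ - θ_p)(k)` (the modewise integral identity of weak solutions,
in tree, with zero velocity, then the a.e. Volterra lemma). [folklore] -/
theorem tilde_mode_eq (hν : 0 < ν) (hh : IsSmooth h) (hmean : HasZeroMean h) (hθ₀ : MemLp θ₀ 2 volume)
    (hweak : IsWeakScalarTransportForced ν (fun (_ : ℝ) (_ : UnitAddTorus d) => (0 : EuclideanSpace ℝ d))
      (fun _ => h) θ₀ θ) {T : ℝ} (hT : 0 < T) (k : d → ℤ) :
    ∀ᵐ t ∂(volume.restrict (Ioo 0 T)),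
      mFourierCoeff (fun x => ((θ t x - steadyState ν h x : ℝ) : ℂ)) k =
        Complex.exp (-(((4 * Real.pi ^ 2 * ν * freqNormSq k : ℝ)) : ℂ) * t) *
          mFourierCoeff (fun x => ((θ₀ x - steadyState ν h x : ℝ) : ℂ)) k := by
  have hW := tilde_isWeak hν hh hmean hθ₀ hweak hT
  have hdat : Integrable (fun x => θ₀ x - steadyState ν h x) volume :=
    (hθ₀.integrable one_le_two).sub (isSmooth_steadyState ν hh).integrable
  have hmode := hW.ae_mFourierCoeff_eq hdat k
  have hz := hW.integrableOn_mFourierCoeff k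
  refine ae_eq_exp_of_volterra (z₀ := mFourierCoeff (fun x => ((θ₀ x - steadyState ν h x : ℝ) : ℂ)) k)
    (a := (((4 * Real.pi ^ 2 * ν * freqNormSq k : ℝ)) : ℂ)) hz ?_
  filter_upwards [hmode] with t ht
  rw [ht]
  congr 1
  refine integral_congr_ae (Eventually.of_forall fun s => ?_)
  simp [mFourierCoeff_zero_fun]

end RestFlowCore



section SlicesForFloor

variable [DecidableEq d] [Nonempty d]
variable {ν : ℝ} {h θ₀ : UnitAddTorus d → ℝ} {θ : ℝ → UnitAddTorus d → ℝ}

omit [DecidableEq d] [Nonempty d] in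
/-- `∫ f² ≤ (∫⁻ ‖f‖ₑ²).toReal`-type conversion for `f ∈ L²`: `∫ f² = (∫⁻ ‖f‖ₑ²).toReal`. [folklore] -/
theorem integral_sq_eq_toReal_lintegral {f : UnitAddTorus d → ℝ} (hf : MemLp f 2 volume) :
    ∫ x, f x ^ 2 = (∫⁻ x, ‖f x‖ₑ ^ 2).toReal := by
  rw [integral_eq_lintegral_of_nonneg_ae (Eventually.of_forall fun x => sq_nonneg (f x))
    (hf.integrable_sq.aestronglyMeasurable)]
  congr 1
  refine lintegral_congr fun x => ?_
  rw [Real.enorm_eq_ofReal_abs, ← ENNReal.ofReal_pow (abs_nonneg _), sq_abs]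

omit [DecidableEq d] [Nonempty d] in
/-- **Slices of a rest-flow solution**: for a.e. `t ∈ (0,T)`, `θ(t) ∈ L²`, `θ̃(t) ∈ L²`, and
`𝓕θ(t)(k) = 𝓕θ̃(t)(k) + 𝓕θ_p(k)`. [folklore] -/
theorem ae_slice (hh : IsSmooth h)
    (hweak : IsWeakScalarTransportForced ν (fun (_ : ℝ) (_ : UnitAddTorus d) => (0 : EuclideanSpace ℝ d))
      (fun _ => h) θ₀ θ) {T : ℝ} (hT : 0 < T) (k : d → ℤ) :
    ∀ᵐ t ∂(volume.restrict (Ioo 0 T)), MemLp (θ t) 2 volume ∧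
      MemLp (fun x => θ t x - steadyState ν h x) 2 volume ∧
      mFourierCoeff (fun x => (θ t x : ℂ)) k =
        mFourierCoeff (fun x => ((θ t x - steadyState ν h x : ℝ) : ℂ)) k +
          mFourierCoeff (fun x => (steadyState ν h x : ℂ)) k := by
  have hθp : IsSmooth (steadyState ν h) := isSmooth_steadyState ν hh
  filter_upwards [forced_ae_memLp_two (hweak T hT)] with t ht
  have ht' : MemLp (fun x => θ t x - steadyState ν h x) 2 volume := ht.sub (hθp.memLp 2)
  refine ⟨ht, ht', ?_⟩
  have e : (fun x => (θ t x : ℂ)) = (fun x => ((θ t x - steadyState ν h x : ℝ) : ℂ)) +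
      fun x => (steadyState ν h x : ℂ) := by
    funext x; simp
  rw [e, FunctionSpaces.Torus.mFourierCoeff_add]
  · exact (ht'.integrable one_le_two).ofReal
  · exact hθp.integrable.ofReal

omit [DecidableEq d] [Nonempty d] in
/-- `t ↦ ‖θ(t)‖²` is a.e.-strongly measurable on `(0,T)` (forced class). [folklore] -/
theorem aestronglyMeasurable_scalarL2Sq {T κ : ℝ} {u : ℝ → UnitAddTorus d → EuclideanSpace ℝ d}
    {s : ℝ → UnitAddTorus d → ℝ} (hw : IsWeakScalarTransportForcedOn T κ u s θ₀ θ) :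
    AEStronglyMeasurable (fun t => scalarL2Sq (θ t)) (volume.restrict (Ioo 0 T)) := by
  have hm := forced_aestronglyMeasurable_uncurry hw
  have h2 : AEStronglyMeasurable (fun p : ℝ × UnitAddTorus d => (uncurry θ p) ^ 2)
      (((volume : Measure ℝ).restrict (Ioo 0 T)).prod volume) := hm.pow 2
  exact h2.integral_prod_right'

omit [DecidableEq d] [Nonempty d] in
/-- `‖e^{-at}‖ = e^{-at}` for real `a, t`. [folklore] -/
theorem norm_cexp_neg_real (a t : ℝ) : ‖Complex.exp (-(a : ℂ) * t)‖ = Real.exp (-a * t) := by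
  have : -(a : ℂ) * (t : ℂ) = ((-a * t : ℝ) : ℂ) := by push_cast; ring
  rw [this, Complex.norm_exp, Complex.ofReal_re]


end SlicesForFloor

end Summit.AnomalousDissipation.AnomalousDissipation.Theorems.ScalarAnomalySteadySourceFormal.Negative
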